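import Summits.RiemannHypothesis.RiemannHypothesis.Theorems.PfPersistenceInWindowMirror
import Summits.RiemannHypothesis.RiemannHypothesis.Theorems.PfPersistenceWeilParityPair
import HarnessLib

/-!
# PF persistence — the IN-WINDOW ONE-DIAL MIRROR for the ODD block (pub-rhpf, barrier-typer gen 6)

**HONEST FRAMING. This is a long-odds MECHANISM SEARCH; no RH claims.** Everything below is RH-free linear
algebra and elementary trigonometry about the cell's observatory records; nothing here bears on the truth of RH.

RULING A106 (adj-3, optional item for the barrier-typer): the ODD-block instance of band 1 of RULING A73 (F) —
the single-field reader `|ε₁^{odd}(a, N)|` at ONE window is matched EXACTLY by ONE prime dial INSIDE that window,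
the matched datum's ODD block being form-negative AT THE SAME WINDOW. The even instance is
`inWindowDialMatchingAt_abs_bottomRayleigh` (`PfPersistenceInWindowMirror`, a64008032a3a); the odd block became a
tree object with cand-6's `oddBlock` / `oddDatum` (`PfPersistenceWeilParityPair`, 023ff2bd28f7), so the odd
instance can now be stated and proved.

* §0 dimension-free forms of three `bottomRayleigh` toolkit lemmas (the odd block is `N × N`, possibly `0 × 0`,
  where `bottomRayleigh = sInf ∅ = 0`).
* §1 the ODD one-prime pattern `P⁻_p = (θ⁻_{i+1,j+1}(log p))` and the dial law
  `oddBlock (dial p K w) = oddBlock w − (2 (K−1) w(p)) • P⁻_p` (PROVED, same bookkeeping as `evenBlock_dial_eq`).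
* §2 the odd dial path `K ↦ ε₁^{odd}(dial p K ζ; win)` is Lipschitz, hence continuous (PROVED).
* §3 a direction moved by the dial EXISTS: for `N ≥ 2` and `0 < log p < 2a` the odd pattern has a nonzero
  Rayleigh value (PROVED from the closed forms `θ⁻₁₂(y) = 8 sin³(πy/L) cos(πy/L) / (3π)`, nonzero off the window
  midpoint `y = L/2`, and `θ⁻₁₁(L/2) = −1/2`, plus polarization for symmetric matrices). For `N = 1` the single
  entry `θ⁻₁₁(log p)` does vanish at one interior position, so `2 ≤ N` is the honest binder (every served window
  has `N ≥ 40`).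
* §4 THE ODD IN-WINDOW MIRROR (PROVED): with the ONLY arithmetic binder `0 < ε₁^{odd}(ζ; win)` (the regime of
  interest), some `K* ≠ 1` has `ε₁^{odd}(dial p K* ζ; win) = −ε₁^{odd}(ζ; win)` exactly (intermediate value theorem
  along the dial), so `OddInWindowDialMatchingAt win (d ↦ |ε₁(oddDatum d win)|)` holds
  (`oddInWindowDialMatchingAt_abs_oddBottom`), and no criterion factoring through `|ε₁^{odd}|` at such a window
  distinguishes `ζ` from an arithmetic dial-space datum that is ODD-negative at the same window
  (`FactorsThrough.exists_oddNegative_twin`).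

Typer placement (MEMBERSHIP.md Gen-6 row 'A106'): this binds the odd single-field magnitude reader to the kernel
with a SAME-WINDOW odd-negative witness; the W1 placement of every finite-window two-parity reader (R23) is
unaffected.
-/

set_option linter.dupNamespace false  -- the mandated namespace repeats `RiemannHypothesis`

noncomputable section

open Real Finset Matrix Set

namespace Summit.RiemannHypothesis.RiemannHypothesis.Theorems.PfPersistence

open Summit.RiemannHypothesis.RiemannHypothesis.Theorems.PfPersistenceParityTransfer (thetaOdd)

/-! ## §0 Dimension-free forms of the `bottomRayleigh` toolkit -/

/-- PROVED: on `Fin 0` there are no nonzero vectors, so the Rayleigh set is empty and `bottomRayleigh = sInf ∅ = 0`. [folklore] -/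
theorem bottomRayleigh_fin_zero (M : Matrix (Fin 0) (Fin 0) ℝ) : bottomRayleigh M = 0 := by
  have h : {r : ℝ | ∃ v : Fin 0 → ℝ, v ≠ 0 ∧ r = v ⬝ᵥ (M *ᵥ v) / (v ⬝ᵥ v)} = ∅ :=
    Set.eq_empty_of_forall_notMem fun r ⟨v, hv, _⟩ => hv (Subsingleton.elim v 0)
  rw [bottomRayleigh, h, Real.sInf_empty]

/-- PROVED: `0 < uᵀu` for `u ≠ 0`, any dimension. [folklore] -/
private theorem dotProduct_self_pos_fin {n : ℕ} {u : Fin n → ℝ} (hu : u ≠ 0) : 0 < u ⬝ᵥ u :=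
  lt_of_le_of_ne (dotProduct_self_nonneg_real u) fun h => hu (dotProduct_self_eq_zero.1 h.symm)

/-- PROVED (the `τ_unif`-Lipschitz law of `ε₁`, any dimension, nonnegative tolerance): form-closeness
`|vᵀ(M − M')v| ≤ δ vᵀv` gives `|ε₁(M) − ε₁(M')| ≤ δ`. [folklore] -/
theorem abs_bottomRayleigh_sub_le_of_nonneg {n : ℕ} {M M' : Matrix (Fin n) (Fin n) ℝ} {δ : ℝ} (hδ : 0 ≤ δ)
    (h : ∀ v : Fin n → ℝ, |v ⬝ᵥ ((M - M') *ᵥ v)| ≤ δ * (v ⬝ᵥ v)) :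
    |bottomRayleigh M - bottomRayleigh M'| ≤ δ := by
  cases n with
  | zero => rw [bottomRayleigh_fin_zero, bottomRayleigh_fin_zero, sub_self, abs_zero]; exact hδ
  | succ k => exact abs_bottomRayleigh_sub_le h

/-- PROVED: a negative bottom is witnessed by a form-negative vector, any dimension (in dimension `0` the bottom
is `0`, so the hypothesis is void). [folklore] -/
theorem exists_form_neg_of_bottomRayleigh_neg_fin {n : ℕ} (M : Matrix (Fin n) (Fin n) ℝ)
    (h : bottomRayleigh M < 0) : ∃ v : Fin n → ℝ, v ⬝ᵥ (M *ᵥ v) < 0 := by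
  cases n with
  | zero => rw [bottomRayleigh_fin_zero] at h; exact absurd h (lt_irrefl 0)
  | succ k => exact exists_form_neg_of_bottomRayleigh_neg M h

/-! ## §1 The odd one-prime pattern and the odd dial law -/

/-- the ODD ONE-PRIME PATTERN at a window: `(i, j) ↦ θ⁻_{i+1, j+1}(log p)` on the odd modes `1 … N` — the
direction in which the `p`-dial moves the odd block (companion of `primePattern`). -/
def oddPrimePattern (p : ℕ) (win : Window) : Matrix (Fin win.N) (Fin win.N) ℝ :=
  fun i j => thetaOdd (2 * win.a) ((i : ℕ) + 1) ((j : ℕ) + 1) (Real.log p)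

/-- PROVED: the odd pattern is symmetric (`thetaOdd_symm`). [folklore] -/
theorem oddPrimePattern_isSymm (p : ℕ) (win : Window) : (oddPrimePattern p win).IsSymm :=
  Matrix.IsSymm.ext fun i j => by
    simp only [oddPrimePattern]; rw [thetaOdd_symm]

/-- PROVED: entrywise, a dial at `p ∈ primeRange (2a)` shifts the odd block by `−2 (K−1) w(p) θ⁻_{i+1,j+1}(log p)`. [folklore] -/
theorem oddBlock_dial_apply {p : ℕ} {win : Window} (hp : p ∈ primeRange (2 * win.a)) (K : ℝ) (w : Weights)
    (i j : Fin win.N) :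
    oddBlock (dial p K w) win i j
      = oddBlock w win i j - 2 * (K - 1) * w p * thetaOdd (2 * win.a) ((i : ℕ) + 1) ((j : ℕ) + 1) (Real.log p) := by
  simp only [oddBlock, weil]; rw [WP_dial_of_mem hp]; ring

/-- **PROVED (ODD DIAL LAW):** `oddBlock (dial p K w) = oddBlock w − (2 (K−1) w(p)) • oddPrimePattern p` at
windows reaching `p`. [folklore] -/
theorem oddBlock_dial_eq {p : ℕ} {win : Window} (hp : p ∈ primeRange (2 * win.a)) (K : ℝ) (w : Weights) :
    oddBlock (dial p K w) win = oddBlock w win - (2 * (K - 1) * w p) • oddPrimePattern p win := by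
  ext i j
  simp only [oddBlock_dial_apply hp, oddPrimePattern, Matrix.sub_apply, Matrix.smul_apply, smul_eq_mul]

/-- PROVED (LOCALITY, odd block): a dial beyond the reach of the window leaves the odd block identical. [folklore] -/
theorem oddBlock_dial_of_not_mem {p : ℕ} {win : Window} (hp : Real.exp (2 * win.a) < p) (K : ℝ) (w : Weights) :
    oddBlock (dial p K w) win = oddBlock w win := by
  ext i j
  simp only [oddBlock, weil]
  rw [WP_dial_of_not_mem (not_mem_primeRange_iff.2 hp)]

/-- PROVED: two dials at the same in-range `p` differ by a multiple of the odd pattern. [folklore] -/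
theorem oddBlock_dial_sub_dial {p : ℕ} {win : Window} (hp : p ∈ primeRange (2 * win.a)) (K K' : ℝ) (w : Weights) :
    oddBlock (dial p K w) win - oddBlock (dial p K' w) win = (2 * (K' - K) * w p) • oddPrimePattern p win := by
  rw [oddBlock_dial_eq hp, oddBlock_dial_eq hp]
  ext i j
  simp only [Matrix.sub_apply, Matrix.smul_apply, smul_eq_mul]
  ring

/-- PROVED: the Rayleigh value of a fixed vector moves AFFINELY along the odd `p`-dial,
`uᵀM(K)u = uᵀMu − 2(K−1) w(p) · uᵀP⁻_p u`. [folklore] -/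
theorem form_oddBlock_dial {p : ℕ} {win : Window} (hp : p ∈ primeRange (2 * win.a)) (K : ℝ) (w : Weights)
    (u : Fin win.N → ℝ) :
    u ⬝ᵥ (oddBlock (dial p K w) win *ᵥ u)
      = u ⬝ᵥ (oddBlock w win *ᵥ u) - 2 * (K - 1) * w p * (u ⬝ᵥ (oddPrimePattern p win *ᵥ u)) := by
  rw [oddBlock_dial_eq hp, rayleigh_sub_smul]

/-! ## §2 The odd dial path `K ↦ ε₁^{odd}(dial p K; win)` is Lipschitz -/

/-- the bottom of `ζ`'s ODD block dialled by `K` at `p`, read at `win` (schema: `eps1_odd` of the two-sided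
`p`-dial record). -/
def oddDialBottom (p : ℕ) (win : Window) (K : ℝ) : ℝ := bottomRayleigh (oddBlock (dial p K zetaWeights) win)

/-- PROVED: at `K = 1` the dialled odd bottom is `ζ`'s odd bottom. [folklore] -/
@[simp] theorem oddDialBottom_one (p : ℕ) (win : Window) :
    oddDialBottom p win 1 = bottomRayleigh (oddBlock zetaWeights win) := by
  simp [oddDialBottom]

/-- **PROVED — the odd dial path is LIPSCHITZ:** `|ε₁⁻(K) − ε₁⁻(K')| ≤ 2 |w(p)| (Σ|P⁻_{ij}|) |K − K'|`
(crude entrywise constant; no closed-form bound on `θ⁻` needed). [folklore] -/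
theorem abs_oddDialBottom_sub_le (p : ℕ) (win : Window) (K K' : ℝ) :
    |oddDialBottom p win K - oddDialBottom p win K'|
      ≤ 2 * |zetaWeights p| * entrySum (oddPrimePattern p win) * |K - K'| := by
  have hE := entrySum_nonneg (oddPrimePattern p win)
  unfold oddDialBottom
  by_cases hp : p ∈ primeRange (2 * win.a)
  · refine abs_bottomRayleigh_sub_le_of_nonneg (by positivity) fun v => ?_
    rw [oddBlock_dial_sub_dial hp, Matrix.smul_mulVec, dotProduct_smul, smul_eq_mul, abs_mul]
    have h1 := abs_form_le_entrySum_mul (oddPrimePattern p win) v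
    have h2 : |2 * (K' - K) * zetaWeights p| = 2 * |zetaWeights p| * |K - K'| := by
      rw [abs_mul, abs_mul, abs_two, abs_sub_comm]; ring
    rw [h2]
    calc 2 * |zetaWeights p| * |K - K'| * |v ⬝ᵥ (oddPrimePattern p win *ᵥ v)|
        ≤ 2 * |zetaWeights p| * |K - K'| * (entrySum (oddPrimePattern p win) * (v ⬝ᵥ v)) :=
          mul_le_mul_of_nonneg_left h1 (by positivity)
      _ = 2 * |zetaWeights p| * entrySum (oddPrimePattern p win) * |K - K'| * (v ⬝ᵥ v) := by ring
  · have hp' := not_mem_primeRange_iff.1 hp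
    rw [oddBlock_dial_of_not_mem hp', oddBlock_dial_of_not_mem hp', sub_self, abs_zero]
    positivity

/-- **PROVED — the odd dial path is CONTINUOUS.** [folklore] -/
theorem continuous_oddDialBottom (p : ℕ) (win : Window) : Continuous (oddDialBottom p win) := by
  have hL : LipschitzWith ⟨2 * |zetaWeights p| * entrySum (oddPrimePattern p win),
      by have := entrySum_nonneg (oddPrimePattern p win); positivity⟩ (oddDialBottom p win) := by
    refine LipschitzWith.of_dist_le_mul fun K K' => ?_
    rw [Real.dist_eq, Real.dist_eq]
    exact abs_oddDialBottom_sub_le p win K K'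
  exact hL.continuous

/-! ## §3 A direction moved by the dial: the odd pattern has a nonzero Rayleigh value (`N ≥ 2`) -/

/-- PROVED (polarization): a symmetric matrix with a nonzero entry has a nonzero Rayleigh value — `eᵢ`, `eⱼ` or
`eᵢ + eⱼ` works. [folklore] -/
theorem exists_form_ne_zero_of_isSymm {n : ℕ} {P : Matrix (Fin n) (Fin n) ℝ} (hP : P.IsSymm) {i j : Fin n}
    (h : P i j ≠ 0) : ∃ u : Fin n → ℝ, u ⬝ᵥ (P *ᵥ u) ≠ 0 := by
  have hss : ∀ k l : Fin n, (Pi.single k 1 : Fin n → ℝ) ⬝ᵥ (P *ᵥ Pi.single l 1) = P k l := fun k l => by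
    simp [single_dotProduct]
  by_cases hii : P i i ≠ 0
  · exact ⟨Pi.single i 1, by rwa [hss]⟩
  by_cases hjj : P j j ≠ 0
  · exact ⟨Pi.single j 1, by rwa [hss]⟩
  push Not at hii hjj
  refine ⟨Pi.single i 1 + Pi.single j 1, ?_⟩
  have hji : P j i = P i j := hP.apply i j
  rw [Matrix.mulVec_add, dotProduct_add, add_dotProduct, add_dotProduct, hss, hss, hss, hss, hii, hjj, hji]
  intro h0
  apply h
  linarith

/-- PROVED (closed form): `θ⁻₁₁(L/2) = −1/2` — at the window midpoint the first odd diagonal pattern entry is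
`−1/2`. [folklore] -/
theorem thetaOdd_one_one_half {L : ℝ} (hL : L ≠ 0) : thetaOdd L 1 1 (L / 2) = -1 / 2 := by
  have e : 2 * π * ((1 : ℕ) : ℝ) * (L / 2) / L = π := by field_simp; ring
  simp only [thetaOdd, if_true, e, Real.cos_pi, Real.sin_pi, zero_div, add_zero]
  field_simp; ring

/-- PROVED (closed form): `θ⁻₁₂(y) = 8 sin³(πy/L) cos(πy/L) / (3π)`. [folklore] -/
theorem thetaOdd_one_two_eq (L y : ℝ) :
    thetaOdd L 1 2 y = 8 * Real.sin (π * y / L) ^ 3 * Real.cos (π * y / L) / (3 * π) := by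
  set t := π * y / L with ht
  have e1 : 2 * π * ((1 : ℕ) : ℝ) * y / L = 2 * t := by rw [ht]; push_cast; ring
  have e2 : 2 * π * ((2 : ℕ) : ℝ) * y / L = 2 * (2 * t) := by rw [ht]; push_cast; ring
  have h12 : (1 : ℕ) ≠ 2 := by norm_num
  simp only [thetaOdd, if_neg h12, e1, e2]
  rw [Real.sin_two_mul (2 * t), Real.sin_two_mul t, Real.cos_two_mul t]
  have hsc := Real.sin_sq_add_cos_sq t
  have hπ : (π : ℝ) ≠ 0 := Real.pi_ne_zero
  push_cast
  rw [div_eq_div_iff (by positivity) (by positivity)]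
  linear_combination (-(24 : ℝ) * π * Real.sin t * Real.cos t) * hsc

/-- PROVED: off the window midpoint, `0 < y < L`, `y ≠ L/2` ⇒ `θ⁻₁₂(y) ≠ 0`. [folklore] -/
theorem thetaOdd_one_two_ne_zero {L y : ℝ} (hL : 0 < L) (hy0 : 0 < y) (hyL : y < L) (hmid : y ≠ L / 2) :
    thetaOdd L 1 2 y ≠ 0 := by
  rw [thetaOdd_one_two_eq]
  have ht0 : 0 < π * y / L := by positivity
  have htπ : π * y / L < π := by
    rw [div_lt_iff₀ hL]; nlinarith [Real.pi_pos]
  have hsin : 0 < Real.sin (π * y / L) := Real.sin_pos_of_pos_of_lt_pi ht0 htπ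
  have hcos : Real.cos (π * y / L) ≠ 0 := by
    rcases lt_or_gt_of_ne hmid with hlt | hgt
    · refine (Real.cos_pos_of_mem_Ioo ⟨by linarith, ?_⟩).ne'
      rw [div_lt_iff₀ hL]; nlinarith [Real.pi_pos]
    · refine (Real.cos_neg_of_pi_div_two_lt_of_lt ?_ (by linarith)).ne
      rw [lt_div_iff₀ hL]; nlinarith [Real.pi_pos]
  have hπ : (0 : ℝ) < 3 * π := by positivity
  exact div_ne_zero (mul_ne_zero (mul_ne_zero (by norm_num) (pow_ne_zero 3 hsin.ne')) hcos) hπ.ne'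

/-- **PROVED — A DIRECTION MOVED BY THE ODD DIAL EXISTS:** for `N ≥ 2` and `0 < log p < 2a` some vector has a
nonzero odd-pattern Rayleigh value (entry `θ⁻₁₂(log p)` off the midpoint `log p = a`, entry `θ⁻₁₁ = −1/2` at
it, then polarization). For `N = 1` this can fail (the single entry `θ⁻₁₁(log p)` has an interior zero). [folklore] -/
theorem exists_oddPattern_form_ne_zero {win : Window} (h2 : 2 ≤ win.N) {p : ℕ} (hp0 : 0 < Real.log p)
    (hpa : Real.log p < 2 * win.a) :
    ∃ u : Fin win.N → ℝ, u ⬝ᵥ (oddPrimePattern p win *ᵥ u) ≠ 0 := by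
  have ha := win.ha
  let i0 : Fin win.N := ⟨0, by omega⟩
  let i1 : Fin win.N := ⟨1, by omega⟩
  by_cases hmid : Real.log p = win.a
  · refine exists_form_ne_zero_of_isSymm (oddPrimePattern_isSymm p win) (i := i0) (j := i0) ?_
    have e : oddPrimePattern p win i0 i0 = thetaOdd (2 * win.a) 1 1 (2 * win.a / 2) := by
      simp only [oddPrimePattern, i0, hmid]; ring_nf
    rw [e, thetaOdd_one_one_half (by linarith)]
    norm_num
  · refine exists_form_ne_zero_of_isSymm (oddPrimePattern_isSymm p win) (i := i0) (j := i1) ?_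
    have e : oddPrimePattern p win i0 i1 = thetaOdd (2 * win.a) 1 2 (Real.log p) := by
      simp only [oddPrimePattern, i0, i1, zero_add]
    rw [e]
    exact thetaOdd_one_two_ne_zero (by linarith) hp0 hpa (fun h => hmid (by linarith))

/-! ## §4 The odd in-window one-dial mirror -/

/-- **PROVED — THE ODD IN-WINDOW ONE-DIAL MIRROR (general direction).** At a window reaching the prime `p`, with
`0 < ε₁⁻ := ε₁^{odd}(ζ; win)` and ANY vector `u` with nonzero odd-pattern value `s := uᵀP⁻_p u`: the dial
`K_R := 1 + (uᵀMu + ε₁⁻ uᵀu)/(2 w(p) s)` drives `u`'s Rayleigh quotient to `−ε₁⁻`, so by the intermediate value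
theorem along the continuous odd dial path some `K* ≠ 1` has `ε₁⁻(K*) = −ε₁⁻` EXACTLY. [folklore] -/
theorem exists_oddDial_bottom_eq_neg {win : Window} {p : ℕ} (hp : p.Prime) (hpw : p ∈ primeRange (2 * win.a))
    (hpos : 0 < bottomRayleigh (oddBlock zetaWeights win)) {u : Fin win.N → ℝ}
    (hs : u ⬝ᵥ (oddPrimePattern p win *ᵥ u) ≠ 0) :
    ∃ K : ℝ, K ≠ 1 ∧ oddDialBottom p win K = -bottomRayleigh (oddBlock zetaWeights win) := by
  set ε₁ := bottomRayleigh (oddBlock zetaWeights win) with hε₁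
  set s := u ⬝ᵥ (oddPrimePattern p win *ᵥ u) with hsdef
  have hwp : 0 < zetaWeights p := zetaWeights_pos_of_prime hp
  have hu : u ≠ 0 := by rintro rfl; simp [hsdef] at hs
  have huu : 0 < u ⬝ᵥ u := dotProduct_self_pos_fin hu
  have hQu : ε₁ * (u ⬝ᵥ u) ≤ u ⬝ᵥ (oddBlock zetaWeights win *ᵥ u) := bottomRayleigh_mul_le_form _ u
  set K_R : ℝ := 1 + (u ⬝ᵥ (oddBlock zetaWeights win *ᵥ u) + ε₁ * (u ⬝ᵥ u)) / (2 * zetaWeights p * s)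
    with hKR
  have hden : 2 * zetaWeights p * s ≠ 0 := mul_ne_zero (by positivity) hs
  have hKR1 : K_R ≠ 1 := by
    intro h
    have : (u ⬝ᵥ (oddBlock zetaWeights win *ᵥ u) + ε₁ * (u ⬝ᵥ u)) / (2 * zetaWeights p * s) = 0 := by
      linarith
    rcases div_eq_zero_iff.1 this with h0 | h0
    · nlinarith [mul_pos hpos huu]
    · exact hden h0
  have hform : u ⬝ᵥ (oddBlock (dial p K_R zetaWeights) win *ᵥ u) = -ε₁ * (u ⬝ᵥ u) := by
    rw [form_oddBlock_dial hpw]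
    have : 2 * (K_R - 1) * zetaWeights p * s
        = u ⬝ᵥ (oddBlock zetaWeights win *ᵥ u) + ε₁ * (u ⬝ᵥ u) := by
      rw [hKR]; field_simp; ring
    linarith
  have hKRle : oddDialBottom p win K_R ≤ -ε₁ := by
    have := bottomRayleigh_le_rayleigh (oddBlock (dial p K_R zetaWeights) win) hu
    rwa [hform, mul_div_assoc, div_self huu.ne', mul_one] at this
  have h1 : oddDialBottom p win 1 = ε₁ := oddDialBottom_one p win
  have hcont := continuous_oddDialBottom p win
  have htarget : -ε₁ ∈ Icc (oddDialBottom p win K_R) (oddDialBottom p win 1) :=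
    ⟨hKRle, by rw [h1]; linarith⟩
  rcases le_total 1 K_R with hle | hle
  · obtain ⟨K, -, hK⟩ := intermediate_value_Icc' hle hcont.continuousOn htarget
    refine ⟨K, fun hK1 => ?_, hK⟩
    rw [hK1, h1] at hK; linarith
  · obtain ⟨K, -, hK⟩ := intermediate_value_Icc hle hcont.continuousOn htarget
    refine ⟨K, fun hK1 => ?_, hK⟩
    rw [hK1, h1] at hK; linarith

/-- **TYPED — ODD IN-WINDOW DIAL MATCHING AT `win` for the reader `F`:** some NONEMPTY composite of dials at
PRIMES INSIDE the window applied to `ζ` (i) reads exactly like `ζ` under `F`, (ii) has an odd block different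
from `ζ`'s AT `win`, and (iii) has a form-negative ODD block AT `win` (odd-type negativity at the same window;
companion of `InWindowDialMatchingAt`, whose clause (iii) is even-block negativity). -/
def OddInWindowDialMatchingAt (win : Window) {ρ : Type} (F : Datum → ρ) : Prop :=
  ∃ L : List (ℕ × ℝ), L ≠ [] ∧ (∀ pk ∈ L, pk.1.Prime ∧ Real.log pk.1 < 2 * win.a) ∧
    F (datumOf (multiDial L zetaWeights)) = F zetaDatum ∧
    oddDatum (datumOf (multiDial L zetaWeights)) win ≠ oddDatum zetaDatum win ∧
    ∃ v : Fin win.N → ℝ, v ⬝ᵥ (oddDatum (datumOf (multiDial L zetaWeights)) win *ᵥ v) < 0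

/-- PROVED: the matched datum is an arithmetic dial-space member, `≠ ζ`, reading like `ζ`, ODD-negative at `win`. [folklore] -/
theorem OddInWindowDialMatchingAt.exists_mem_arithDialSpace {win : Window} {ρ : Type} {F : Datum → ρ}
    (h : OddInWindowDialMatchingAt win F) :
    ∃ d ∈ arithDialSpace, d ≠ zetaDatum ∧ F d = F zetaDatum ∧ oddDatum d win ≠ oddDatum zetaDatum win ∧
      ∃ v : Fin win.N → ℝ, v ⬝ᵥ (oddDatum d win *ᵥ v) < 0 := by
  obtain ⟨L, -, -, hF, hne, v, hv⟩ := h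
  exact ⟨_, datumOf_multiDial_zeta_mem_arithDialSpace L, fun heq => hne (by rw [heq]), hF, hne, v, hv⟩

/-- **PROVED — RULING A106, ODD BAND 1 AS A THEOREM: the reader `|ε₁^{odd}|` at one window is mirrored by ONE
in-window prime dial.** For every window with `N ≥ 2`, every prime `p` strictly inside it (`log p < 2a`) and
`0 < ε₁^{odd}(ζ; win)` (the ONLY arithmetic binder): `OddInWindowDialMatchingAt win (d ↦ |ε₁(oddDatum d win)|)`,
witnessed by a single dial `(p, K*)`, `K* ≠ 1`, with `ε₁^{odd}(K*) = −ε₁^{odd}(ζ)` exactly. [folklore] -/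
theorem oddInWindowDialMatchingAt_abs_oddBottom (win : Window) (h2 : 2 ≤ win.N) {p : ℕ} (hp : p.Prime)
    (hpa : Real.log p < 2 * win.a) (hpos : 0 < bottomRayleigh (oddBlock zetaWeights win)) :
    OddInWindowDialMatchingAt win (fun d : Datum => |bottomRayleigh (oddDatum d win)|) := by
  have hpw : p ∈ primeRange (2 * win.a) := mem_primeRange_of_log_le hpa.le
  have hp0 : 0 < Real.log p := Real.log_pos (by exact_mod_cast hp.one_lt)
  obtain ⟨u, hs⟩ := exists_oddPattern_form_ne_zero h2 hp0 hpa
  obtain ⟨K, hK1, hK⟩ := exists_oddDial_bottom_eq_neg hp hpw hpos hs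
  refine ⟨[(p, K)], List.cons_ne_nil _ _, fun pk hpk => ?_, ?_, ?_, ?_⟩
  · simp only [List.mem_singleton] at hpk; subst hpk; exact ⟨hp, hpa⟩
  · show |bottomRayleigh (oddDatum (datumOf (multiDial [(p, K)] zetaWeights)) win)|
        = |bottomRayleigh (oddDatum zetaDatum win)|
    rw [multiDial_singleton, oddDatum_datumOf, zetaDatum, oddDatum_datumOf]
    change |oddDialBottom p win K| = _
    rw [hK, abs_neg]
  · rw [multiDial_singleton, oddDatum_datumOf, zetaDatum, oddDatum_datumOf]
    intro heq
    have hb : oddDialBottom p win K = bottomRayleigh (oddBlock zetaWeights win) := by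
      unfold oddDialBottom; rw [heq]
    rw [hK] at hb
    linarith
  · rw [multiDial_singleton, oddDatum_datumOf]
    apply exists_form_neg_of_bottomRayleigh_neg_fin
    change oddDialBottom p win K < 0
    rw [hK]; linarith

/-- PROVED (the `p = 2` instance): at every window with `N ≥ 2`, `log 2 < 2a` and `ε₁^{odd}(ζ; a, N) > 0`, the
`|ε₁^{odd}|`-reader is mirrored by one in-window `2`-dial. [folklore] -/
theorem oddInWindowDialMatchingAt_abs_oddBottom_two (win : Window) (h2 : 2 ≤ win.N)
    (ha : Real.log 2 < 2 * win.a) (hpos : 0 < bottomRayleigh (oddBlock zetaWeights win)) :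
    OddInWindowDialMatchingAt win (fun d : Datum => |bottomRayleigh (oddDatum d win)|) :=
  oddInWindowDialMatchingAt_abs_oddBottom win h2 Nat.prime_two (by exact_mod_cast ha) hpos

/-- **PROVED — SAME-WINDOW ODD-NEGATIVE TWIN for `|ε₁^{odd}|`-readers (closure word of record
`closed-global (thm | served sign ε₁^{odd}(ζ; a, N) > 0, N ≥ 2)`):** a criterion whose membership factors through
`|ε₁^{odd}(a, N)|` at a window containing a prime gives the SAME verdict on `ζ` and on an arithmetic dial-space
datum `≠ ζ` whose odd block is form-negative AT `(a, N)`. [folklore] -/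
theorem FactorsThrough.exists_oddNegative_twin {S : Set Datum} (win : Window) (h2 : 2 ≤ win.N)
    (hS : FactorsThrough S (fun d : Datum => |bottomRayleigh (oddDatum d win)|))
    {p : ℕ} (hp : p.Prime) (hpa : Real.log p < 2 * win.a) (hpos : 0 < bottomRayleigh (oddBlock zetaWeights win)) :
    ∃ d ∈ arithDialSpace, d ≠ zetaDatum ∧ (d ∈ S ↔ zetaDatum ∈ S) ∧
      ∃ v : Fin win.N → ℝ, v ⬝ᵥ (oddDatum d win *ᵥ v) < 0 := by
  obtain ⟨d, hd, hne, hF, -, v, hv⟩ :=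
    (oddInWindowDialMatchingAt_abs_oddBottom win h2 hp hpa hpos).exists_mem_arithDialSpace
  exact ⟨d, hd, hne, hS d zetaDatum hF, v, hv⟩

end Summit.RiemannHypothesis.RiemannHypothesis.Theorems.PfPersistence

end
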